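import Summits.KontsevichZagierPeriods.KontsevichZagierPeriods.Theses.SymplecticScissors
import Literature.NumberTheory.Transcendental.AyoubPeriodSeries
import Literature.NumberTheory.Transcendental.AyoubPeriodSeriesKernel
import Literature.NumberTheory.Transcendental.AyoubPeriodSeriesPiAlgebraic
import Literature.NumberTheory.Transcendental.AyoubPeriodSeriesLocalizing
import Literature.NumberTheory.Transcendental.AyoubPeriodSeriesVariables
import Summits.KontsevichZagierPeriods.KontsevichZagierPeriods.Theorems.UnfoldedStokesStokesGenerationStubSpanToRepsAuxCoeff
import Mathlib.RingTheory.MvPowerSeries.Rename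

/-!
# `TypeAGeneration` (stmt-KontsevichZagierPeriods-18392), line `Sketch`, stub `stub_renameSpan` (R)

Registered stub `stub_renameSpan` of the crux `TypeAGeneration` (route SymplecticScissors, line
`Sketch`), on top of `Literature/NumberTheory/Transcendental/AyoubPeriodSeries.lean`
(`AyoubRel.Oan σ = 𝒪_{k-alg}(𝔻̄^∞)`: power series in finitely many `zᵢ`, of polyradius `> 1`,
algebraic over `k(z)`; `AyoubRel.relAC n = ∂/∂zₙ − (·)|_{zₙ=1} + (·)|_{zₙ=0}`, the type-(a)
operator of J. Ayoub, *Une version relative de la conjecture des périodes de Kontsevich–Zagier*,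
Ann. of Math. 181 (2015), Thm. 1.1; `AyoubRel.kSpan σ S`, finite `σ(k)`-combinations).

**Renaming the variables** by a permutation `e : ℕ ≃ ℕ` (Mathlib's `MvPowerSeries.rename ⇑e`,
`F ↦ F^e`, `z_l ↦ z_{e l}`) is a mere reindexing of coefficients
(`r1_coeff_rename`: `coeff_b F^e = coeff_{b ∘ e} F`), hence

* it commutes with `∂ₙ`, with the faces `(·)|_{zₙ = c}` and with the type-(a) operator up to
  `n ↦ e n` (`r1_rename_pdz`, `r1_rename_restrC`, `r1_rename_relAC`; termwise identities, no
  convergence needed);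
* it preserves `𝒪_{k-alg}(𝔻̄^∞)` (`r1_rename_mem_Oan`): finitely many variables
  (`r1_dependsOnlyOnLT_rename`, bound `max_{i<m} (e i + 1)`), the polyradius (`|b ∘ e| = |b|`,
  `r1_hasPolyradiusGtOne_rename`) and algebraicity over `k(z)` (`r1_isAlgebraicOverRatFunc_rename`:
  `rename ⇑e` restricts along `k[z] → ℂ[[z]]` to the injective endomorphism `p ↦ p^e` of `k[z]`,
  so `P(G) = 0` is transported to `P^e(G^e) = 0`, `P^e ≠ 0`);
* hence it preserves the `k`-span of the type-(a) elements (`r1_rename_mem_kSpan`).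

Elementary (folklore); helper names carry the prefix `r1`; no definition is introduced.
-/

noncomputable section

-- `Summit.KontsevichZagierPeriods.KontsevichZagierPeriods.…` is the tree's mandated layout (single-conjunct summit).
set_option linter.dupNamespace false

namespace Summit.KontsevichZagierPeriods.KontsevichZagierPeriods.TypeAGenerationLine

open Finsupp MvPowerSeries
open Literature.NumberTheory.Transcendental
open Literature.NumberTheory.Transcendental.AyoubRel

/-! ## Coefficients of a renamed series -/

section Coeff

/-- `e ∘ e⁻¹ = id` on exponents: `mapDomain e (mapDomain e⁻¹ b) = b`. [folklore] -/
theorem r1_mapDomain_mapDomain_symm (e : ℕ ≃ ℕ) (b : ℕ →₀ ℕ) :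
    mapDomain (⇑e) (mapDomain (⇑e.symm) b) = b := by
  rw [← mapDomain_comp, Equiv.self_comp_symm, mapDomain_id]

/-- `e⁻¹ ∘ e = id` on exponents: `mapDomain e⁻¹ (mapDomain e a) = a`. [folklore] -/
theorem r1_mapDomain_symm_mapDomain (e : ℕ ≃ ℕ) (a : ℕ →₀ ℕ) :
    mapDomain (⇑e.symm) (mapDomain (⇑e) a) = a := by
  rw [← mapDomain_comp, Equiv.symm_comp_self, mapDomain_id]

/-- `(mapDomain e⁻¹ b) l = b (e l)`, i.e. `mapDomain e⁻¹ b = b ∘ e`. [folklore] -/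
theorem r1_mapDomain_symm_apply (e : ℕ ≃ ℕ) (b : ℕ →₀ ℕ) (l : ℕ) :
    mapDomain (⇑e.symm) b l = b (e l) := by
  rw [mapDomain_equiv_apply, Equiv.symm_symm]

/-- `mapDomain e⁻¹ (b + m e_{e l}) = mapDomain e⁻¹ b + m e_l`. [folklore] -/
theorem r1_mapDomain_symm_add_single (e : ℕ ≃ ℕ) (b : ℕ →₀ ℕ) (l m : ℕ) :
    mapDomain (⇑e.symm) (b + single (e l) m) = mapDomain (⇑e.symm) b + single l m := by
  rw [mapDomain_add, mapDomain_single, Equiv.symm_apply_apply]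

/-- **Coefficients of the renamed series** `F^e = rename e F` (`z_l ↦ z_{e l}`):
`coeff_b (F^e) = coeff_{b ∘ e} F`. [folklore] -/
theorem r1_coeff_rename (e : ℕ ≃ ℕ) (F : CSeries) (b : ℕ →₀ ℕ) :
    coeff b (MvPowerSeries.rename (⇑e) F) = coeff (mapDomain (⇑e.symm) b) F := by
  have hx : embDomain e.toEmbedding (mapDomain (⇑e.symm) b) = b := by
    rw [embDomain_eq_mapDomain, Equiv.coe_toEmbedding, r1_mapDomain_mapDomain_symm]
  have h := coeff_embDomain_rename e.toEmbedding F (mapDomain (⇑e.symm) b)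
  rw [hx] at h
  exact h

/-- `coeff_{e_* a} (F^e) = coeff_a F`. [folklore] -/
theorem r1_coeff_mapDomain_rename (e : ℕ ≃ ℕ) (F : CSeries) (a : ℕ →₀ ℕ) :
    coeff (mapDomain (⇑e) a) (MvPowerSeries.rename (⇑e) F) = coeff a F := by
  rw [r1_coeff_rename, r1_mapDomain_symm_mapDomain]

end Coeff

/-! ## Renaming commutes with `∂ₙ`, the faces and the type-(a) operator -/

section Commute

/-- `(∂ₙ G)^e = ∂_{e n} (G^e)`. [folklore] -/
theorem r1_rename_pdz (e : ℕ ≃ ℕ) (n : ℕ) (G : CSeries) :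
    MvPowerSeries.rename (⇑e) (pdz n G) = pdz (e n) (MvPowerSeries.rename (⇑e) G) := by
  ext b
  rw [r1_coeff_rename, StokesGenerationLine.coeff_pdz, StokesGenerationLine.coeff_pdz,
    r1_coeff_rename, r1_mapDomain_symm_apply, r1_mapDomain_symm_add_single]

/-- `(G|_{zₙ = c})^e = (G^e)|_{z_{e n} = c}`. [folklore] -/
theorem r1_rename_restrC (e : ℕ ≃ ℕ) (n : ℕ) (c : ℂ) (G : CSeries) :
    MvPowerSeries.rename (⇑e) (restrC n c G) =
      restrC (e n) c (MvPowerSeries.rename (⇑e) G) := by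
  ext b
  rw [r1_coeff_rename, StokesGenerationLine.coeff_restrC, StokesGenerationLine.coeff_restrC,
    r1_mapDomain_symm_apply]
  simp only [r1_coeff_rename, r1_mapDomain_symm_add_single]

/-- **Renaming commutes with the type-(a) operator**: `(relAC n G)^e = relAC (e n) (G^e)`.
[folklore] -/
theorem r1_rename_relAC (e : ℕ ≃ ℕ) (n : ℕ) (G : CSeries) :
    MvPowerSeries.rename (⇑e) (relAC n G) = relAC (e n) (MvPowerSeries.rename (⇑e) G) := by
  rw [relAC, relAC, map_add, map_sub, r1_rename_pdz, r1_rename_restrC, r1_rename_restrC]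

end Commute

/-! ## Renaming preserves `𝒪_{k-alg}(𝔻̄^∞)` -/

section Oan

variable {k : Type} [Field k] (σ : k →+* ℂ)

/-- Renaming keeps finitely many variables: if `G` involves only `z_0, …, z_{m-1}` then `G^e`
involves only `z_l` with `l < max_{i<m} (e i + 1)`. [folklore] -/
theorem r1_dependsOnlyOnLT_rename (e : ℕ ≃ ℕ) {G : CSeries} {m : ℕ} (hG : DependsOnlyOnLT G m) :
    DependsOnlyOnLT (MvPowerSeries.rename (⇑e) G) ((Finset.range m).sup fun i => e i + 1) := by
  rintro b ⟨l, hl, hbl⟩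
  rw [r1_coeff_rename]
  refine hG _ ⟨e.symm l, ?_, ?_⟩
  · by_contra h
    have h1 : e (e.symm l) + 1 ≤ (Finset.range m).sup fun i => e i + 1 :=
      Finset.le_sup (f := fun i => e i + 1) (Finset.mem_range.mpr (not_le.mp h))
    rw [Equiv.apply_symm_apply] at h1
    omega
  · rwa [r1_mapDomain_symm_apply, Equiv.apply_symm_apply]

/-- Renaming preserves the polyradius: `|b ∘ e| = |b|`, and `b ↦ b ∘ e` is a bijection of the
exponents. [folklore] -/
theorem r1_hasPolyradiusGtOne_rename (e : ℕ ≃ ℕ) {G : CSeries} (hG : HasPolyradiusGtOne G) :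
    HasPolyradiusGtOne (MvPowerSeries.rename (⇑e) G) := by
  obtain ⟨r, hr, hs⟩ := hG
  refine ⟨r, hr, ?_⟩
  have heq : (fun b : ℕ →₀ ℕ => ‖coeff b (MvPowerSeries.rename (⇑e) G)‖ * r ^ degree b) =
      (fun a : ℕ →₀ ℕ => ‖coeff a G‖ * r ^ degree a) ∘ mapDomain (⇑e.symm) := by
    funext b
    simp only [Function.comp_apply, r1_coeff_rename, degree_mapDomain]
  rw [heq]
  exact ((mapDomain_injective e.symm.injective).summable_iff fun x hx =>
    (hx ⟨mapDomain (⇑e) x, r1_mapDomain_symm_mapDomain e x⟩).elim).mpr hs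

/-- Renaming commutes with `k[z] → ℂ[[z]]`: `(p(z))^e = p^e(z)`. [folklore] -/
theorem r1_rename_polyToCSeries (e : ℕ ≃ ℕ) (p : MvPolynomial ℕ k) :
    MvPowerSeries.rename (⇑e) (polyToCSeries σ p) =
      polyToCSeries σ (MvPolynomial.rename (⇑e) p) := by
  simp only [polyToCSeries, RingHom.comp_apply, MvPolynomial.coeToMvPowerSeries.ringHom_apply,
    rename_coe, MvPolynomial.map_rename]

/-- Renaming preserves algebraicity over `k(z)`: `rename ⇑e` restricts along `k[z] → ℂ[[z]]` to
the injective endomorphism `p ↦ p^e` of `k[z]`, so a relation `P(G) = 0` is transported to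
`P^e(G^e) = 0` with `P^e ≠ 0`. [folklore] -/
theorem r1_isAlgebraicOverRatFunc_rename (e : ℕ ≃ ℕ) {G : CSeries}
    (hG : IsAlgebraicOverRatFunc σ G) : IsAlgebraicOverRatFunc σ (MvPowerSeries.rename (⇑e) G) := by
  obtain ⟨P, hP0, hP⟩ := hG
  set φ : CSeries →+* CSeries := (MvPowerSeries.rename (R := ℂ) (⇑e)).toRingHom with hφ
  set f : MvPolynomial ℕ k →+* MvPolynomial ℕ k :=
    (MvPolynomial.rename (R := k) (⇑e)).toRingHom with hf
  have hφ' : ∀ F : CSeries, φ F = MvPowerSeries.rename (⇑e) F := fun F => rfl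
  have hf' : ∀ p : MvPolynomial ℕ k, f p = MvPolynomial.rename (⇑e) p := fun p => rfl
  have hinj : Function.Injective f := fun p q hpq =>
    MvPolynomial.rename_injective _ e.injective (by rwa [hf', hf'] at hpq)
  have hcomm : φ.comp (polyToCSeries σ) = (polyToCSeries σ).comp f := RingHom.ext fun p => by
    rw [RingHom.comp_apply, RingHom.comp_apply, hφ', hf', r1_rename_polyToCSeries]
  have h2 : Polynomial.eval₂ (φ.comp (polyToCSeries σ)) (φ G) P = 0 := by
    rw [← Polynomial.hom_eval₂, hP, map_zero]
  refine ⟨P.map f, (Polynomial.map_ne_zero_iff hinj).mpr hP0, ?_⟩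
  rw [Polynomial.eval₂_map, ← hcomm]
  exact h2

/-- **Renaming preserves `𝒪_{k-alg}(𝔻̄^∞)`**: `G^e ∈ 𝒪_{k-alg}(𝔻̄^∞)` for `G ∈ 𝒪_{k-alg}(𝔻̄^∞)`
and any permutation `e` of the variables. [folklore] -/
theorem r1_rename_mem_Oan (e : ℕ ≃ ℕ) {G : CSeries} (hG : G ∈ Oan σ) :
    MvPowerSeries.rename (⇑e) G ∈ Oan σ := by
  obtain ⟨⟨m, hm⟩, hr, halg⟩ := hG
  exact ⟨⟨_, r1_dependsOnlyOnLT_rename e hm⟩, r1_hasPolyradiusGtOne_rename e hr,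
    r1_isAlgebraicOverRatFunc_rename σ e halg⟩

/-- **Renaming preserves the `k`-span of type (a)**:
`(Σ σ(c_j) relAC n_j G_j)^e = Σ σ(c_j) relAC (e n_j) G_j^e`. [folklore] -/
theorem r1_rename_mem_kSpan (e : ℕ ≃ ℕ) {x : CSeries}
    (hx : x ∈ kSpan σ {x : CSeries | ∃ G ∈ Oan σ, ∃ n : ℕ, x = relAC n G}) :
    MvPowerSeries.rename (⇑e) x ∈ kSpan σ {x : CSeries | ∃ G ∈ Oan σ, ∃ n : ℕ, x = relAC n G} := by
  obtain ⟨N, c, s, hs, rfl⟩ := hx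
  refine ⟨N, c, fun j => MvPowerSeries.rename (⇑e) (s j), fun j => ?_, ?_⟩
  · obtain ⟨G, hG, n, hn⟩ := hs j
    refine ⟨_, r1_rename_mem_Oan σ e hG, e n, ?_⟩
    dsimp only
    rw [hn, r1_rename_relAC]
  · rw [map_sum]
    exact Finset.sum_congr rfl fun j _ => map_smul _ _ _

end Oan

/-! ## Registered form -/

/-- **R — renaming the variables preserves the `ℚ`-span of type (a).** For a permutation
`e : ℕ ≃ ℕ` of the variables (`F ↦ F^e = rename e F`, `z_l ↦ z_{e l}`): (1) `G^e ∈ 𝒪_{ℚ-alg}(𝔻̄^∞)`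
for `G ∈ 𝒪_{ℚ-alg}(𝔻̄^∞)` (coefficients are permuted: finitely many variables, same polyradius,
algebraicity transported along the injective renaming of `ℚ[z]`); (2) `(relAC n G)^e =
relAC (e n) (G^e)` (termwise); (3) hence `x^e` lies in the `ℚ`-span `𝕊` of the type-(a) elements
whenever `x` does. [folklore] -/
theorem stub_renameSpan :
    ∀ (e : ℕ ≃ ℕ),
      (∀ G : CSeries, G ∈ Oan (algebraMap ℚ ℂ) →
        MvPowerSeries.rename (⇑e) G ∈ Oan (algebraMap ℚ ℂ)) ∧
      (∀ (G : CSeries) (n : ℕ), G ∈ Oan (algebraMap ℚ ℂ) →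
        MvPowerSeries.rename (⇑e) (relAC n G) = relAC (e n) (MvPowerSeries.rename (⇑e) G)) ∧
      (∀ x : CSeries, x ∈ kSpan (algebraMap ℚ ℂ)
          {x : CSeries | ∃ G ∈ Oan (algebraMap ℚ ℂ), ∃ n : ℕ, x = relAC n G} →
        MvPowerSeries.rename (⇑e) x ∈
          kSpan (algebraMap ℚ ℂ)
            {x : CSeries | ∃ G ∈ Oan (algebraMap ℚ ℂ), ∃ n : ℕ, x = relAC n G}) :=
  fun e => ⟨fun _ hG => r1_rename_mem_Oan _ e hG, fun G n _ => r1_rename_relAC e n G,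
    fun _ hx => r1_rename_mem_kSpan _ e hx⟩

end Summit.KontsevichZagierPeriods.KontsevichZagierPeriods.TypeAGenerationLine
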